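import Summits.BirchSwinnertonDyer.BirchSwinnertonDyer.Theses.LeadingTerm
import Literature.NumberTheory.EllipticCurves.ComplexMultiplicationRationalJIntegralProofs
import Literature.NumberTheory.EllipticCurves.SzpiroLocalDataProofs
import Literature.NumberTheory.EllipticCurves.DegreeConjectureAbcPrelims
import Literature.NumberTheory.EllipticCurves.RootNumberProofs
import Literature.NumberTheory.EllipticCurves.QuadraticTwistKroneckerLFunctionProofs

/-!
# `LeadingTerm.TamePinchR` (crux stmt-BirchSwinnertonDyer-17007): the pinch prime cannot be bounded
# or chosen uniformly (refuted natural strengthenings; negative-side support — this file does NOT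
# refute the crux)

`TamePinchR` asserts, for every NON-CM globally minimal elliptic `W/ℚ`, the EXISTENCE of an
admissible prime `p ≥ 5` (good ordinary, `ρ̄_{W,p}` onto `GL₂(𝔽_p)`) carrying a Kurihara-number
certificate. Two natural strengthenings are false for an elementary reason and are refuted here:

* `not_tamePinchR_bounded B` — "the admissible certificate prime can be taken `≤ B`" is false for
  every `B`;
* `not_tamePinchR_uniform` — "one prime `p ≥ 5` serves every non-CM curve" (`∃ p ∀ W`) is false.

The witnesses come from the one-parameter family `W_b = [1,0,0,0,b] : y² + xy = x³ + b` (`b ∈ ℤ`):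
`c₄ = 1` and `Δ = −b(1 + 432 b)`, so for `b ≠ 0` the equation is elliptic and GLOBALLY MINIMAL
(`c₄` is a unit at every prime, Silverman AEC VII.1 Remark 1.1), it has BAD reduction at every
prime `p ∣ b` (minimal with `p ∣ Δ`, AEC VII.5 Prop. 5.1(a)), and it is NON-CM as soon as `2 ∣ b`
(`j = c₄³/Δ = −1/(b(1+432b))`, `‖j‖₂ = ‖b‖₂⁻¹ > 1`, while CM `j`-invariants are integers — tree
theorem `WeierstrassCurve.not_hasCM_of_one_lt_norm_j`, Silverman ATAEC II.6). Taking `b = 2·B!`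
kills every prime `p ≤ B` at once. Consequence for provers: the `∃ p` of the crux is genuinely
curve-dependent (at least on the conductor); no finite search and no prescribed prime can realise
it. Standing-disprover seat refuter-cdisprove-stmt-BirchSwinnertonDyer-17007-0, cycle 1; work file
`Cruxes/TamePinchR/Disproof.lean` §§2–3. All statements are theorem-only (the curve is written as a
literal; no auxiliary `def`).
-/

noncomputable section

-- D-0017: single-problem summit, so `Summit.BirchSwinnertonDyer.BirchSwinnertonDyer.…` repeats a
-- namespace BY DESIGN.
set_option linter.dupNamespace false

namespace Summit.BirchSwinnertonDyer.BirchSwinnertonDyer.Theorems.TamePinchR.Negative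

open scoped MatrixGroups ModularForm
open CongruenceSubgroup IsDedekindDomain Literature.NumberTheory.EllipticCurves
  Literature.NumberTheory.EllipticCurves.ModularForms
open WeierstrassCurve

/-! ### The family `W_b = [1,0,0,0,b]` -/

/-- `Δ(W_b) = −b(1 + 432 b)` over `ℤ`. [folklore] -/
theorem family_int_Δ (b : ℤ) : (⟨1, 0, 0, 0, b⟩ : WeierstrassCurve ℤ).Δ = -b * (1 + 432 * b) := by
  simp only [WeierstrassCurve.Δ, WeierstrassCurve.b₂, WeierstrassCurve.b₄, WeierstrassCurve.b₆,
    WeierstrassCurve.b₈]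
  ring

/-- `c₄(W_b) = 1` over `ℤ`. [folklore] -/
theorem family_int_c₄ (b : ℤ) : (⟨1, 0, 0, 0, b⟩ : WeierstrassCurve ℤ).c₄ = 1 := by
  simp only [WeierstrassCurve.c₄, WeierstrassCurve.b₂, WeierstrassCurve.b₄]
  ring

/-- `Δ(W_b) = −b(1 + 432 b)` over `ℚ`. [folklore] -/
theorem family_Δ (b : ℚ) : (⟨1, 0, 0, 0, b⟩ : WeierstrassCurve ℚ).Δ = -b * (1 + 432 * b) := by
  simp only [WeierstrassCurve.Δ, WeierstrassCurve.b₂, WeierstrassCurve.b₄, WeierstrassCurve.b₆,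
    WeierstrassCurve.b₈]
  ring

/-- `c₄(W_b) = 1` over `ℚ`. [folklore] -/
theorem family_c₄ (b : ℚ) : (⟨1, 0, 0, 0, b⟩ : WeierstrassCurve ℚ).c₄ = 1 := by
  simp only [WeierstrassCurve.c₄, WeierstrassCurve.b₂, WeierstrassCurve.b₄]
  ring

/-- The integral model base-changes to the rational one. [folklore] -/
theorem family_baseChange (b : ℤ) :
    ((⟨1, 0, 0, 0, b⟩ : WeierstrassCurve ℤ).baseChange ℚ) =
      (⟨1, 0, 0, 0, (b : ℚ)⟩ : WeierstrassCurve ℚ) := by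
  simp only [WeierstrassCurve.baseChange, WeierstrassCurve.map]
  ext <;> simp

/-- `W_b` is elliptic for every integer `b ≠ 0` (`Δ = −b(1+432b)` and `1 + 432 b ≠ 0` in `ℤ`).
[folklore] -/
theorem family_isElliptic (b : ℤ) (hb : b ≠ 0) :
    (⟨1, 0, 0, 0, (b : ℚ)⟩ : WeierstrassCurve ℚ).IsElliptic := by
  refine ⟨?_⟩
  rw [family_Δ, isUnit_iff_ne_zero]
  have hb' : (b : ℚ) ≠ 0 := by exact_mod_cast hb
  have h1 : (1 + 432 * b : ℚ) ≠ 0 := by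
    intro h
    have h' : ((1 + 432 * b : ℤ) : ℚ) = 0 := by push_cast; exact h
    have h'' : (1 + 432 * b : ℤ) = 0 := by exact_mod_cast h'
    omega
  exact mul_ne_zero (neg_ne_zero.mpr hb') h1

/-- `W_b` is minimal at every prime: `c₄ = 1` is a unit (Silverman AEC VII.1 Remark 1.1; tree
criterion `isMinimalAt_baseChange_int_of_not_dvd_c₄`). [folklore] -/
theorem family_isMinimalAt (b : ℤ) (v : HeightOneSpectrum ℤ) :
    ((⟨1, 0, 0, 0, b⟩ : WeierstrassCurve ℤ).baseChange ℚ).IsMinimalAt v := by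
  refine isMinimalAt_baseChange_int_of_not_dvd_c₄ ?_
  rw [family_int_c₄]
  intro h
  have hp := Rat.HeightOneSpectrum.prime_natGenerator v
  have h1 : (Rat.HeightOneSpectrum.natGenerator v : ℤ) ∣ ((1 : ℕ) : ℤ) := by simpa using h
  exact hp.not_dvd_one (Int.natCast_dvd_natCast.mp h1)

/-- `W_b` is a global minimal model for every integer `b`. [folklore] -/
theorem family_isGloballyMinimal (b : ℤ) :
    (⟨1, 0, 0, 0, (b : ℚ)⟩ : WeierstrassCurve ℚ).IsGloballyMinimal := by
  rw [← family_baseChange]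
  exact isGloballyMinimal_of_forall_isMinimalAt_int _ (family_isMinimalAt b)

/-- `W_b` has bad reduction at every prime `p ∣ b`: the equation is minimal at `p` and
`p ∣ Δ = −b(1+432b)` (Silverman AEC VII.5 Prop. 5.1(a); tree
`hasGoodReductionAt_iff_of_isMinimalAt`, `hasGoodReductionAtPrime_iff_hasGoodReductionAt_holds`).
[folklore] -/
theorem family_not_hasGoodReductionAtPrime (b : ℤ) (p : ℕ) [hp : Fact p.Prime]
    (hpb : (p : ℤ) ∣ b) :
    ¬ (⟨1, 0, 0, 0, (b : ℚ)⟩ : WeierstrassCurve ℚ).HasGoodReductionAtPrime p := by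
  have hiff := hasGoodReductionAtPrime_iff_hasGoodReductionAt_holds
    (⟨1, 0, 0, 0, (b : ℚ)⟩ : WeierstrassCurve ℚ) ⟨p, hp.out⟩
  rw [hiff, ← family_baseChange, hasGoodReductionAt_iff_of_isMinimalAt (family_isMinimalAt b _),
    baseChange_int_Δ, Literature.NumberTheory.EllipticCurves.Rat.valuation_intCast_eq_one_iff,
    Literature.NumberTheory.EllipticCurves.Rat.natGenerator_primesEquiv_symm, not_not, family_int_Δ]
  exact (dvd_neg.mpr hpb).mul_right _

/-- `W_b` has no complex multiplication when `b ≠ 0` is even: `j = c₄³/Δ = −1/(b(1+432b))` has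
`‖j‖₂ = ‖b‖₂⁻¹ > 1`, and CM `j`-invariants of curves over `ℚ` are integers
(`not_hasCM_of_one_lt_norm_j`, Silverman ATAEC II.6). [folklore] -/
theorem family_not_hasCM (b : ℤ) (hb : b ≠ 0) (h2 : (2 : ℤ) ∣ b) :
    haveI := family_isElliptic b hb
    ¬ (⟨1, 0, 0, 0, (b : ℚ)⟩ : WeierstrassCurve ℚ).HasCM := by
  haveI := family_isElliptic b hb
  haveI : Fact (Nat.Prime 2) := ⟨Nat.prime_two⟩
  refine not_hasCM_of_one_lt_norm_j _ (ℓ := 2) ?_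
  have hj : ((⟨1, 0, 0, 0, (b : ℚ)⟩ : WeierstrassCurve ℚ).j : ℚ) = (-b * (1 + 432 * b) : ℚ)⁻¹ := by
    rw [WeierstrassCurve.j, Units.val_inv_eq_inv_val, WeierstrassCurve.coe_Δ', family_Δ, family_c₄]
    ring
  rw [hj]
  have hcast : (((-b * (1 + 432 * b) : ℚ)⁻¹ : ℚ) : ℚ_[2]) =
      (((-b * (1 + 432 * b) : ℤ) : ℚ_[2]))⁻¹ := by
    push_cast; ring
  rw [hcast, norm_inv]
  have hlt : ‖((-b * (1 + 432 * b) : ℤ) : ℚ_[2])‖ < 1 := by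
    rw [Padic.norm_intCast_lt_one_iff]
    exact (dvd_neg.mpr h2).mul_right _
  have hne : ((-b * (1 + 432 * b) : ℤ) : ℚ_[2]) ≠ 0 := by
    have h0 : (-b * (1 + 432 * b) : ℤ) ≠ 0 := by
      refine mul_ne_zero (neg_ne_zero.mpr hb) ?_
      omega
    exact_mod_cast h0
  exact (one_lt_inv₀ (norm_pos_iff.mpr hne)).mpr hlt

/-- NON-VACUITY supply: for every integer `b ≠ 0` with `2 ∣ b`, `W_b` inhabits the binder of
`TamePinchR` (elliptic, globally minimal, non-CM) and is bad at every prime factor of `b`.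
[folklore] -/
theorem family_inhabits_binder (b : ℤ) (hb : b ≠ 0) (h2 : (2 : ℤ) ∣ b) :
    ∃ (_ : (⟨1, 0, 0, 0, (b : ℚ)⟩ : WeierstrassCurve ℚ).IsElliptic)
      (_ : (⟨1, 0, 0, 0, (b : ℚ)⟩ : WeierstrassCurve ℚ).IsGloballyMinimal),
      ¬ (⟨1, 0, 0, 0, (b : ℚ)⟩ : WeierstrassCurve ℚ).HasCM ∧
        ∀ (p : ℕ) [Fact p.Prime], (p : ℤ) ∣ b →
          ¬ (⟨1, 0, 0, 0, (b : ℚ)⟩ : WeierstrassCurve ℚ).HasGoodReductionAtPrime p :=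
  ⟨family_isElliptic b hb, family_isGloballyMinimal b, family_not_hasCM b hb h2,
    fun p _ hpb ↦ family_not_hasGoodReductionAtPrime b p hpb⟩

/-! ### The refuted strengthenings -/

/-- **STRENGTHENING REFUTED: a bounded pinch prime.** For every `B : ℕ` it is false that every
non-CM globally minimal elliptic `W/ℚ` has an admissible certificate prime `p ≤ B` (the body below
is the conclusion of `TamePinchR` verbatim, with `p ≤ B ∧` inserted): `W_{2·B!}` is elliptic,
globally minimal and non-CM, and has bad — in particular not good ordinary — reduction at every
prime `p ≤ B` (`p ∣ B! ∣ 2·B! ∣ Δ`). The `∃ p` of the crux cannot be bounded by any absolute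
constant. [folklore] -/
theorem not_tamePinchR_bounded (B : ℕ) :
    ¬ ∀ (W : WeierstrassCurve ℚ) [W.IsElliptic] [W.IsGloballyMinimal], ¬ W.HasCM →
      ∃ (p : ℕ) (_ : Fact p.Prime), p ≤ B ∧ 5 ≤ p ∧ IsOrdinaryAt W p ∧
        W.HasSurjectiveModNGaloisRep (p : ℤ) ∧
        ∃ (N : ℕ) (_ : NeZero N) (f : CuspForm (Gamma0 N) 2), IsNewformOf W f ∧
          ∃ (n : ℕ) (_ : NeZero n), Squarefree n ∧ n.primeFactors.card = W.mordellWeilRank ∧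
            (∀ ℓ ∈ n.primeFactors, ¬ ℓ ∣ N * p ∧ (ℓ : ZMod p) = 1 ∧
              (W.frobeniusTrace ℓ : ZMod p) = 2) ∧
            ∃ ψ : (ℓ : ℕ) → (ZMod ℓ)ˣ →* Multiplicative (ZMod p),
              (∀ ℓ ∈ n.primeFactors, Function.Surjective (ψ ℓ)) ∧
              (∑ a : (ZMod n)ˣ, (ratPlusSymbol f (((a : ZMod n).val : ℚ) / n) : ZMod p) *
                ∏ ℓ ∈ n.primeFactors.attach,
                  Multiplicative.toAdd
                    (ψ ℓ.1 (ZMod.unitsMap (Nat.dvd_of_mem_primeFactors ℓ.2) a))) ≠ 0 := by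
  intro h
  set b : ℤ := 2 * (B.factorial : ℤ) with hbdef
  have hb : b ≠ 0 := by
    have := B.factorial_pos
    positivity
  haveI := family_isElliptic b hb
  haveI := family_isGloballyMinimal b
  obtain ⟨p, hp, hpB, -, hord, -⟩ := h ⟨1, 0, 0, 0, (b : ℚ)⟩
    (family_not_hasCM b hb (dvd_mul_right 2 _))
  refine family_not_hasGoodReductionAtPrime b p ?_ hord.1
  exact (dvd_mul_left _ _).trans (mul_dvd_mul_left 2
    (Int.natCast_dvd_natCast.mpr (Nat.dvd_factorial hp.out.pos hpB)))

/-- **STRENGTHENING REFUTED: a uniform pinch prime (`∃ p ∀ W`).** No single prime `p ≥ 5` carries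
the certificate of `TamePinchR` for every non-CM globally minimal elliptic `W/ℚ`: `W_{2·p!}` is bad
at `p`. [folklore] -/
theorem not_tamePinchR_uniform :
    ¬ ∃ (p : ℕ) (_ : Fact p.Prime), 5 ≤ p ∧
      ∀ (W : WeierstrassCurve ℚ) [W.IsElliptic] [W.IsGloballyMinimal], ¬ W.HasCM →
        IsOrdinaryAt W p ∧ W.HasSurjectiveModNGaloisRep (p : ℤ) ∧
        ∃ (N : ℕ) (_ : NeZero N) (f : CuspForm (Gamma0 N) 2), IsNewformOf W f ∧
          ∃ (n : ℕ) (_ : NeZero n), Squarefree n ∧ n.primeFactors.card = W.mordellWeilRank ∧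
            (∀ ℓ ∈ n.primeFactors, ¬ ℓ ∣ N * p ∧ (ℓ : ZMod p) = 1 ∧
              (W.frobeniusTrace ℓ : ZMod p) = 2) ∧
            ∃ ψ : (ℓ : ℕ) → (ZMod ℓ)ˣ →* Multiplicative (ZMod p),
              (∀ ℓ ∈ n.primeFactors, Function.Surjective (ψ ℓ)) ∧
              (∑ a : (ZMod n)ˣ, (ratPlusSymbol f (((a : ZMod n).val : ℚ) / n) : ZMod p) *
                ∏ ℓ ∈ n.primeFactors.attach,
                  Multiplicative.toAdd
                    (ψ ℓ.1 (ZMod.unitsMap (Nat.dvd_of_mem_primeFactors ℓ.2) a))) ≠ 0 := by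
  rintro ⟨p, hp, h5, h⟩
  exact not_tamePinchR_bounded p fun W _ _ hCM ↦ ⟨p, hp, le_rfl, h5, h W hCM⟩

end Summit.BirchSwinnertonDyer.BirchSwinnertonDyer.Theorems.TamePinchR.Negative

end
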